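import Literature.Computability.AlgebraicComplexity.Apolarity
import Literature.Computability.AlgebraicComplexity.ApolarityAction
import Mathlib.Algebra.MvPolynomial.PDeriv

/-!
# Border apolarity, crux `FixedWitnessObstructionQP` — limits of annihilator ideals are ideal truncations

Route `ValiantsHypothesis/BorderApolarity`, crux item `stmt-ValiantsHypothesis-5778`, line
`cone-purity-squeeze`, stub `stub_limitIdeal` (normal form N2 of the skeleton): if `J` is the
degree-wise Kuratowski limit of the annihilators `Ann(P t)` in degrees `≤ m`
(`IsBorderApolarLimit m P J`), then `D ∈ J k`, `k + 1 ≤ m` imply `D · Xᵢ ∈ J (k+1)` for every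
variable `i`.

Proof: approximants `D_t ∈ Ann_k(P t)` with `coeffVec D_t → coeffVec D` (Li) give
`Xᵢ · D_t ∈ Ann_{k+1}(P t)` (homogeneity of a product; the derivative rule
`(Xᵢ · D_t) ⌟ f = Xᵢ ⌟ (D_t ⌟ f) = Xᵢ ⌟ 0 = 0`), multiplication by `Xᵢ` is coefficientwise
continuous (`tendsto_coeffVec_X_mul`), and (Ls) along `φ = id` puts the limit `Xᵢ · D` in
`J (k+1)`.  The same argument appears inline in `apolar_all_of_top` of the crux work file
`Cruxes/FixedWitnessObstructionQP/ApolarityAPI.lean`.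
-/

open MvPolynomial Filter
open scoped BigOperators Matrix
open Literature.Computability.AlgebraicComplexity

namespace Summit.ValiantsHypothesis.ValiantsHypothesis.Theorems.BorderApolarityFixedWitnessObstructionQP

/-- Degree-one multipliers preserve annihilators: if `E ∈ Ann_k(f)` then `Xᵢ · E ∈ Ann_{k+1}(f)`
(`(Xᵢ · E) ⌟ f = Xᵢ ⌟ (E ⌟ f)`, the derivative rule of the apolarity action). [folklore] -/
theorem X_mul_mem_annihilatorOfDegree {σ : Type*} {R : Type*} [CommRing R]
    {f E : MvPolynomial σ R} {k : ℕ} (i : σ) (hE : E ∈ annihilatorOfDegree f k) :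
    X i * E ∈ annihilatorOfDegree f (k + 1) := by
  refine ⟨?_, ?_⟩
  · have h := (isHomogeneous_X R i).mul hE.1
    rwa [add_comm] at h
  · rw [apolarAction_X_mul, hE.2, apolarAction_zero_right]

/-- **Limits of annihilator ideals are ideal truncations (degree-one multipliers).**  If `J` is the
degree-wise Kuratowski limit of `Ann(P t)` in degrees `≤ m` (`IsBorderApolarLimit m P J`), then
`D ∈ J k`, `k + 1 ≤ m` ⇒ `D · Xᵢ ∈ J (k+1)` for every variable `i`: approximants
`D_t ∈ Ann_k(P t)` give `Xᵢ · D_t ∈ Ann_{k+1}(P t)`, multiplication by `Xᵢ` is continuous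
coefficientwise, and (Ls) with `φ = id` concludes. [folklore] -/
theorem stub_limitIdeal (m : ℕ) (P : ℕ → MvPolynomial (Fin m × Fin m) ℂ)
    (J : ℕ → Set (MvPolynomial (Fin m × Fin m) ℂ)) (hJ : IsBorderApolarLimit m P J) :
    ∀ k : ℕ, k + 1 ≤ m → ∀ D ∈ J k, ∀ i : Fin m × Fin m, D * MvPolynomial.X i ∈ J (k + 1) := by
  intro k hk D hD i
  obtain ⟨Ds, hDs, hlim⟩ := hJ.exists_tendsto (k := k) (by omega) hD
  rw [mul_comm]
  exact hJ.mem_of_tendsto (k := k + 1) hk (φ := id) (Ds := fun t => X i * Ds t) strictMono_id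
    (fun t => X_mul_mem_annihilatorOfDegree i (hDs t)) (tendsto_coeffVec_X_mul i hlim)

end Summit.ValiantsHypothesis.ValiantsHypothesis.Theorems.BorderApolarityFixedWitnessObstructionQP
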